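import Mathlib
import HarnessLib
import Summits.Ventures.LatticeQCDFlow.Exactness.LaggedAdaptationDoeblin
import Summits.Ventures.LatticeQCDFlow.Exactness.PopulationLeaveOneOutExact

/-!
# LatticeQCDFlow / Exactness — LEARNING ON THE JOB, XV: THE LAG BOUND FOR THE JOINT LAW — from ANY dependence between frozen parameters
# and configuration, `n` steps of the frozen exact `ε`-Doeblin sampler bring the JOINT law within `(1 − ε)ⁿ` of `ρ_H ⊗ π` in total
# variation (epoch-wise retraining, unconditionally)

HONEST FRAMING: exact (Metropolis-corrected) sampling algorithms for lattice gauge theory;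
figures of merit are autocorrelation/cost numbers at stated couplings and volumes; no
continuum-physics claim.

Venture `LatticeQCDFlow` (cell pub-lqcd), topic `Exactness`, FANOUT row 30 (lean-1 GEN-44, theme LEARNING ON THE JOB).  NEW WORK of the
cell; no definition is introduced, nothing is cited as a fact.  Tree inputs: `LaggedAdaptationDoeblin` (`bindKernel_add_measure`),
`PopulationLeaveOneOutExact` (`leaveOneOut_snd_invariant`: a frozen-parameter step preserves every product `m ⊗ π`).  `LaggedAdaptationDoeblin`
bounds the lag-`n` law from every fixed (parameters, configuration) pair; this file integrates over ANY joint law `ρ` of the pair — the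
statement one needs for EPOCH-WISE RETRAINING (fit at the start of the epoch on everything before, arbitrarily correlated with the configuration at
that time; sample the epoch with the fit frozen): the Doeblin split is carried out at the level of measures on `H × Ω`, where the minorising
object is the KERNEL `(h, x) ↦ δ_h ⊗ π` rather than a fixed measure — absorbed because the parameter coordinate never moves.

## Setting
`π` a probability on `Ω`; `κ : Kernel (H × Ω) Ω` Markov with `π`-exact frozen sections (`hκ`) and the uniform minorisation `ε·π(B) ≤ κ(h, x)(B)`
(`hmin`; flows with weights `≤ 1/ε`); the FROZEN-PARAMETER STEP on `H × Ω`, def-free: `Ĵ(h, x)(C) = κ(h, x){y | (h, y) ∈ C}` (`hJ`).  `ρ` any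
probability on `H × Ω`; `ρ_H = ρ.map fst`; `P = ρ_H ⊗ π`.

## Results (no `sorry`)
* §1 `frozenStep_prod_invariant` (`(m ⊗ π)Ĵ = m ⊗ π` for every `m`), `frozenStep_fst` (`Ĵ` keeps the parameter marginal), `frozenStep_minorised`
  (`rĴ ≥ ε·((r.map fst) ⊗ π)` for every measure `r`), linearity bookkeeping.
* §2 **`frozenStep_split`** — THE SPLIT ON THE JOINT SPACE: for every `n` there is a measure `r` with `ρĴⁿ + (1 − ε)ⁿ·P = P + r` and
  `r.map fst = (1 − ε)ⁿ·ρ_H` (so `r` has mass `(1 − ε)ⁿ`).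
* §3 **`frozenStep_joint_real_sub_le`** — `|ρĴⁿ(C) − (ρ_H ⊗ π)(C)| ≤ (1 − ε)ⁿ` for EVERY `C ⊆ H × Ω` (joint events included; outer measure);
  **`frozenStep_config_real_sub_le`** — in particular the configuration after `n` frozen steps is within `(1 − ε)ⁿ` of `π`, whatever the
  dependence between the frozen parameters and the configuration they were computed from; and the joint law DOMINATES `(1 − (1 − ε)ⁿ)·(ρ_H ⊗ π)`
  (**`frozenStep_dominates`**) — the hypothesis of `AdaptationBiasBounds` §1 for the NEXT retraining, with `β = (1 − ε)ⁿ`.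
Reading (gauge files): retrain at epoch boundaries on everything so far, freeze within the epoch: the `n`-th configuration of the epoch is
`(1 − 1/W)ⁿ`-close to `π` in total variation and nearly independent of the epoch's parameters, so the next fit is nearly exogenous.
-/

namespace Summit.Ventures.LatticeQCDFlow.Exactness

open MeasureTheory ProbabilityTheory
open scoped _root_.ENNReal

variable {Ω H : Type*} [MeasurableSpace Ω] [MeasurableSpace H] {π : Measure Ω} [IsProbabilityMeasure π]

/-! ## §1 The frozen-parameter step on the joint space -/

section Frozen

variable (κ : Kernel (H × Ω) Ω) [IsMarkovKernel κ] (J : Kernel (H × Ω) (H × Ω))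
  (hJ : ∀ (h : H) (x : Ω) {C : Set (H × Ω)}, MeasurableSet C → J (h, x) C = κ (h, x) ((fun y => (h, y)) ⁻¹' C))

include hJ

/-- `Ĵ` is Markov. [ours, bookkeeping] -/
theorem frozenStep_isMarkovKernel : IsMarkovKernel J := by
  refine ⟨fun p => ⟨?_⟩⟩
  obtain ⟨h, x⟩ := p
  rw [hJ h x MeasurableSet.univ, Set.preimage_univ, measure_univ]

omit [IsMarkovKernel κ] in
/-- **EVERY PRODUCT `m ⊗ π` IS INVARIANT UNDER THE FROZEN STEP** (the parameters do not move; each section of `κ` is `π`-exact). [ours] -/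
theorem frozenStep_prod_invariant (hκ : ∀ (h : H) {B : Set Ω}, MeasurableSet B → ∫⁻ x, κ (h, x) B ∂π = π B) (m : Measure H) :
    (m.prod π).bind J = m.prod π :=
  (leaveOneOut_snd_invariant (π := m) (π' := π) κ hκ J hJ).def

/-- **THE FROZEN STEP KEEPS THE PARAMETER MARGINAL**: `(μĴ)(A × Ω) = μ(A × Ω)`. [ours] -/
theorem frozenStep_fst (μ : Measure (H × Ω)) {A : Set H} (hA : MeasurableSet A) :
    (μ.bind J) (A ×ˢ Set.univ) = μ (A ×ˢ Set.univ) := by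
  rw [Measure.bind_apply (hA.prod MeasurableSet.univ) (Kernel.aemeasurable _), ← lintegral_indicator_one (hA.prod MeasurableSet.univ)]
  refine lintegral_congr fun p => ?_
  obtain ⟨h, x⟩ := p
  rw [hJ h x (hA.prod MeasurableSet.univ)]
  by_cases hh : h ∈ A
  · rw [show (fun y : Ω => (h, y)) ⁻¹' (A ×ˢ Set.univ) = Set.univ by ext y; simp [hh], measure_univ,
      Set.indicator_of_mem (show (h, x) ∈ A ×ˢ (Set.univ : Set Ω) by simp [hh]), Pi.one_apply]
  · rw [show (fun y : Ω => (h, y)) ⁻¹' (A ×ˢ Set.univ) = ∅ by ext y; simp [hh], measure_empty,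
      Set.indicator_of_notMem (show (h, x) ∉ A ×ˢ (Set.univ : Set Ω) by simp [hh])]

/-- … as an identity of parameter marginals: `(μĴ).map fst = μ.map fst`. [ours] -/
theorem frozenStep_map_fst (μ : Measure (H × Ω)) : (μ.bind J).map Prod.fst = μ.map Prod.fst := by
  ext A hA
  rw [Measure.map_apply measurable_fst hA, Measure.map_apply measurable_fst hA, show Prod.fst ⁻¹' A = A ×ˢ (Set.univ : Set Ω) by
    ext p; simp, frozenStep_fst κ J hJ μ hA]

omit [IsMarkovKernel κ] in
/-- **THE KERNEL MINORISATION, INTEGRATED**: `ε·((r.map fst) ⊗ π)(C) ≤ (rĴ)(C)` for every measure `r` on `H × Ω`. [ours] -/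
theorem frozenStep_minorised {ε : ℝ≥0∞} (hmin : ∀ (h : H) (x : Ω) {B : Set Ω}, MeasurableSet B → ε * π B ≤ κ (h, x) B)
    (r : Measure (H × Ω)) {C : Set (H × Ω)} (hC : MeasurableSet C) :
    ε * ((r.map Prod.fst).prod π) C ≤ (r.bind J) C := by
  rw [Measure.prod_apply hC, lintegral_map (measurable_measure_prodMk_left hC) measurable_fst,
    Measure.bind_apply hC (Kernel.aemeasurable _)]
  refine (lintegral_const_mul_le _ _).trans (lintegral_mono fun p => ?_)
  obtain ⟨h, x⟩ := p
  rw [hJ h x hC]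
  exact hmin h x (measurable_prodMk_left hC)

end Frozen

/-! ## §2 The split on the joint space -/

omit [IsProbabilityMeasure π] in
/-- Cancelling a finite measure: `μ + ν = μ' + ν ⇒ μ = μ'`. [ours, bookkeeping] -/
theorem measure_add_right_cancel {α : Type*} [MeasurableSpace α] {μ μ' ν : Measure α} [IsFiniteMeasure ν] (h : μ + ν = μ' + ν) :
    μ = μ' := by
  ext s hs
  have := congrArg (fun m : Measure α => m s) h
  simp only [Measure.add_apply] at this
  exact (ENNReal.add_left_inj (measure_ne_top ν s)).1 this

/-- **THE SPLIT ON THE JOINT SPACE**: for every probability `ρ` on `H × Ω` and every `n` there is a measure `r` with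
`ρĴⁿ + (1 − ε)ⁿ·(ρ_H ⊗ π) = ρ_H ⊗ π + r` and `r.map fst = (1 − ε)ⁿ·ρ_H`. [ours] -/
theorem frozenStep_split (κ : Kernel (H × Ω) Ω) [IsMarkovKernel κ] (J : Kernel (H × Ω) (H × Ω))
    (hJ : ∀ (h : H) (x : Ω) {C : Set (H × Ω)}, MeasurableSet C → J (h, x) C = κ (h, x) ((fun y => (h, y)) ⁻¹' C))
    (hκ : ∀ (h : H) {B : Set Ω}, MeasurableSet B → ∫⁻ x, κ (h, x) B ∂π = π B) {ε : ℝ≥0∞}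
    (hmin : ∀ (h : H) (x : Ω) {B : Set Ω}, MeasurableSet B → ε * π B ≤ κ (h, x) B) (hε1 : ε ≤ 1)
    (ρ : Measure (H × Ω)) [IsProbabilityMeasure ρ] :
    ∀ n : ℕ, ∃ r : Measure (H × Ω),
      (fun ν : Measure (H × Ω) => ν.bind J)^[n] ρ + (1 - ε) ^ n • ((ρ.map Prod.fst).prod π) = (ρ.map Prod.fst).prod π + r ∧
        r.map Prod.fst = (1 - ε) ^ n • ρ.map Prod.fst := by
  haveI : IsProbabilityMeasure (ρ.map (Prod.fst : H × Ω → H)) := Measure.isProbabilityMeasure_map measurable_fst.aemeasurable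
  set ρH : Measure H := ρ.map Prod.fst with hρH
  set P : Measure (H × Ω) := ρH.prod π with hP
  have hPinv : P.bind J = P := frozenStep_prod_invariant κ J hJ hκ ρH
  have hPfst : P.map Prod.fst = ρH := by rw [hP, Measure.map_fst_prod, measure_univ, one_smul]
  have h1ε : (1 - ε) + ε = 1 := tsub_add_cancel_of_le hε1
  intro n
  induction n with
  | zero => exact ⟨ρ, by simp [add_comm], by simp [hρH]⟩
  | succ n ih =>
    obtain ⟨r, hr, hrH⟩ := ih
    set c : ℝ≥0∞ := (1 - ε) ^ n with hc
    have hc1 : c ≤ 1 := pow_le_one₀ (zero_le) tsub_le_self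
    have hεc : ε * c ≠ ⊤ := ENNReal.mul_ne_top (ne_top_of_le_ne_top ENNReal.one_ne_top hε1) (ne_top_of_le_ne_top ENNReal.one_ne_top hc1)
    haveI : IsFiniteMeasure ((ε * c) • P) :=
      ⟨by rw [Measure.smul_apply, smul_eq_mul, measure_univ, mul_one]; exact hεc.lt_top⟩
    haveI : IsFiniteMeasure ((ε * c) • ρH) :=
      ⟨by rw [Measure.smul_apply, smul_eq_mul, measure_univ, mul_one]; exact hεc.lt_top⟩
    -- one more frozen step applied to the split
    have hstep : (fun ν : Measure (H × Ω) => ν.bind J)^[n + 1] ρ + c • P = P + r.bind J := by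
      have := congrArg (fun ν : Measure (H × Ω) => ν.bind J) hr
      simp only [bindKernel_add_measure, Measure.bind_smul, hPinv] at this
      rw [Function.iterate_succ_apply']
      exact this
    -- the residual of the residual: `rĴ ≥ εc·P`
    have hdom : (ε * c) • P ≤ r.bind J := by
      refine Measure.le_iff.2 fun C hC => ?_
      rw [Measure.smul_apply, smul_eq_mul, mul_assoc]
      have h := frozenStep_minorised κ J hJ hmin r hC
      rwa [hrH, Measure.prod_smul_left, Measure.smul_apply, smul_eq_mul] at h
    refine ⟨r.bind J - (ε * c) • P, ?_, ?_⟩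
    · -- `μ_{n+1} + (1-ε)c·P + εc·P = P + r' + εc·P`, cancel
      have hsplitc : c • P = ((1 - ε) * c) • P + (ε * c) • P := by rw [← add_smul, ← add_mul, h1ε, one_mul]
      refine measure_add_right_cancel (ν := (ε * c) • P) ?_
      rw [pow_succ, mul_comm _ (1 - ε), add_assoc, ← hsplitc, hstep, add_assoc, Measure.sub_add_cancel_of_le hdom]
    · -- parameter marginals: `c·ρ_H = r'_H + εc·ρ_H` and `c·ρ_H = (1-ε)c·ρ_H + εc·ρ_H`
      have hfst : (r.bind J).map Prod.fst = c • ρH := by rw [frozenStep_map_fst κ J hJ, hrH]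
      have hdecomp : (r.bind J).map Prod.fst = (r.bind J - (ε * c) • P).map Prod.fst + (ε * c) • ρH := by
        conv_lhs => rw [← Measure.sub_add_cancel_of_le hdom]
        rw [Measure.map_add _ _ measurable_fst, Measure.map_smul, hPfst]
      have hsplitc : c • ρH = ((1 - ε) * c) • ρH + (ε * c) • ρH := by rw [← add_smul, ← add_mul, h1ε, one_mul]
      refine measure_add_right_cancel (ν := (ε * c) • ρH) ?_
      rw [← hdecomp, hfst, pow_succ, mul_comm _ (1 - ε), ← hsplitc]

/-! ## §3 The bounds -/

/-- **THE JOINT LAW DOMINATES `(1 − (1 − ε)ⁿ)·(ρ_H ⊗ π)` AFTER `n` FROZEN STEPS** — the hypothesis of `AdaptationBiasBounds` §1 for the next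
retraining, with `β = (1 − ε)ⁿ`. [ours] -/
theorem frozenStep_dominates (κ : Kernel (H × Ω) Ω) [IsMarkovKernel κ] (J : Kernel (H × Ω) (H × Ω))
    (hJ : ∀ (h : H) (x : Ω) {C : Set (H × Ω)}, MeasurableSet C → J (h, x) C = κ (h, x) ((fun y => (h, y)) ⁻¹' C))
    (hκ : ∀ (h : H) {B : Set Ω}, MeasurableSet B → ∫⁻ x, κ (h, x) B ∂π = π B) {ε : ℝ≥0∞}
    (hmin : ∀ (h : H) (x : Ω) {B : Set Ω}, MeasurableSet B → ε * π B ≤ κ (h, x) B) (hε1 : ε ≤ 1)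
    (ρ : Measure (H × Ω)) [IsProbabilityMeasure ρ] (n : ℕ) :
    (1 - (1 - ε) ^ n) • ((ρ.map Prod.fst).prod π) ≤ (fun ν : Measure (H × Ω) => ν.bind J)^[n] ρ := by
  haveI : IsProbabilityMeasure (ρ.map (Prod.fst : H × Ω → H)) := Measure.isProbabilityMeasure_map measurable_fst.aemeasurable
  obtain ⟨r, hr, -⟩ := frozenStep_split κ J hJ hκ hmin hε1 ρ n
  have hc1 : (1 - ε) ^ n ≤ 1 := pow_le_one₀ (zero_le) tsub_le_self
  refine Measure.le_iff.2 fun C hC => ?_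
  have h := congrArg (fun m : Measure (H × Ω) => m C) hr
  simp only [Measure.add_apply, Measure.smul_apply, smul_eq_mul] at h
  have hfin : (1 - ε) ^ n * ((ρ.map Prod.fst).prod π) C ≠ ⊤ :=
    ENNReal.mul_ne_top (ne_top_of_le_ne_top ENNReal.one_ne_top hc1) (measure_ne_top _ _)
  rw [Measure.smul_apply, smul_eq_mul]
  refine (ENNReal.add_le_add_iff_right hfin).1 ?_
  rw [← add_mul, tsub_add_cancel_of_le hc1, one_mul, h]
  exact le_self_add

/-- **THE LAG BOUND FOR THE JOINT LAW**: `|ρĴⁿ(C) − (ρ_H ⊗ π)(C)| ≤ (1 − ε)ⁿ` for every measurable `C ⊆ H × Ω` and every initial joint law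
`ρ`. [ours] -/
theorem frozenStep_joint_real_sub_le (κ : Kernel (H × Ω) Ω) [IsMarkovKernel κ] (J : Kernel (H × Ω) (H × Ω))
    (hJ : ∀ (h : H) (x : Ω) {C : Set (H × Ω)}, MeasurableSet C → J (h, x) C = κ (h, x) ((fun y => (h, y)) ⁻¹' C))
    (hκ : ∀ (h : H) {B : Set Ω}, MeasurableSet B → ∫⁻ x, κ (h, x) B ∂π = π B) {ε : ℝ≥0∞}
    (hmin : ∀ (h : H) (x : Ω) {B : Set Ω}, MeasurableSet B → ε * π B ≤ κ (h, x) B) (hε1 : ε ≤ 1)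
    (ρ : Measure (H × Ω)) [IsProbabilityMeasure ρ] (n : ℕ) (C : Set (H × Ω)) :
    |((fun ν : Measure (H × Ω) => ν.bind J)^[n] ρ).real C - ((ρ.map Prod.fst).prod π).real C| ≤ (1 - ε.toReal) ^ n := by
  haveI : IsProbabilityMeasure (ρ.map (Prod.fst : H × Ω → H)) := Measure.isProbabilityMeasure_map measurable_fst.aemeasurable
  obtain ⟨r, hr, hrH⟩ := frozenStep_split κ J hJ hκ hmin hε1 ρ n
  set c : ℝ≥0∞ := (1 - ε) ^ n with hc
  set P : Measure (H × Ω) := (ρ.map Prod.fst).prod π with hP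
  set μn : Measure (H × Ω) := (fun ν : Measure (H × Ω) => ν.bind J)^[n] ρ with hμn
  have hc1 : c ≤ 1 := pow_le_one₀ (zero_le) tsub_le_self
  have hctop : c ≠ ⊤ := ne_top_of_le_ne_top ENNReal.one_ne_top hc1
  have hcreal : c.toReal = (1 - ε.toReal) ^ n := by
    rw [hc, ENNReal.toReal_pow, ENNReal.toReal_sub_of_le hε1 ENNReal.one_ne_top, ENNReal.toReal_one]
  -- the mass of the residual is `c`
  have hrmass : r Set.univ = c := by
    have := congrArg (fun m : Measure H => m Set.univ) hrH
    simp only [Measure.map_apply measurable_fst MeasurableSet.univ, Set.preimage_univ, Measure.smul_apply, smul_eq_mul,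
      measure_univ, mul_one] at this
    exact this
  have h := congrArg (fun m : Measure (H × Ω) => m C) hr
  simp only [Measure.add_apply, Measure.smul_apply, smul_eq_mul] at h
  -- `μn C + c·P C = P C + r C`, `r C ≤ c`, `P C ≤ 1`
  have hrC : r C ≤ c := (measure_mono (Set.subset_univ C)).trans_eq hrmass
  have hPC : P C ≤ 1 := prob_le_one
  have hμfin : μn C ≠ ⊤ := by
    refine ne_top_of_le_ne_top (ENNReal.add_ne_top.2 ⟨measure_ne_top P C, hctop⟩) ?_
    calc μn C ≤ μn C + c * P C := le_self_add
      _ = P C + r C := h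
      _ ≤ P C + c := add_le_add le_rfl hrC
  have hreal := congrArg ENNReal.toReal h
  rw [ENNReal.toReal_add hμfin (ENNReal.mul_ne_top hctop (measure_ne_top _ _)), ENNReal.toReal_add (measure_ne_top _ _)
    (ne_top_of_le_ne_top hctop hrC), ENNReal.toReal_mul, hcreal] at hreal
  have hr0 : 0 ≤ (r C).toReal := ENNReal.toReal_nonneg
  have hr1 : (r C).toReal ≤ (1 - ε.toReal) ^ n := by rw [← hcreal]; exact ENNReal.toReal_mono hctop hrC
  have hP0 : 0 ≤ (P C).toReal := ENNReal.toReal_nonneg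
  have hP1 : (P C).toReal ≤ 1 := by simpa using ENNReal.toReal_mono ENNReal.one_ne_top hPC
  have hcnn : 0 ≤ (1 - ε.toReal) ^ n := by rw [← hcreal]; exact ENNReal.toReal_nonneg
  rw [measureReal_def, measureReal_def, abs_le]
  constructor <;> nlinarith

/-- **… IN PARTICULAR FOR THE CONFIGURATION**: after `n` frozen steps from ANY joint law of (parameters, configuration), the configuration's law
is within `(1 − ε)ⁿ` of `π`: `|ρĴⁿ(H × B) − π(B)| ≤ (1 − ε)ⁿ`. [ours] -/
theorem frozenStep_config_real_sub_le (κ : Kernel (H × Ω) Ω) [IsMarkovKernel κ] (J : Kernel (H × Ω) (H × Ω))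
    (hJ : ∀ (h : H) (x : Ω) {C : Set (H × Ω)}, MeasurableSet C → J (h, x) C = κ (h, x) ((fun y => (h, y)) ⁻¹' C))
    (hκ : ∀ (h : H) {B : Set Ω}, MeasurableSet B → ∫⁻ x, κ (h, x) B ∂π = π B) {ε : ℝ≥0∞}
    (hmin : ∀ (h : H) (x : Ω) {B : Set Ω}, MeasurableSet B → ε * π B ≤ κ (h, x) B) (hε1 : ε ≤ 1)
    (ρ : Measure (H × Ω)) [IsProbabilityMeasure ρ] (n : ℕ) (B : Set Ω) :
    |((fun ν : Measure (H × Ω) => ν.bind J)^[n] ρ).real (Set.univ ×ˢ B) - π.real B| ≤ (1 - ε.toReal) ^ n := by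
  haveI : IsProbabilityMeasure (ρ.map (Prod.fst : H × Ω → H)) := Measure.isProbabilityMeasure_map measurable_fst.aemeasurable
  have h := frozenStep_joint_real_sub_le κ J hJ hκ hmin hε1 ρ n (Set.univ ×ˢ B)
  rwa [measureReal_def ((ρ.map Prod.fst).prod π), Measure.prod_prod, measure_univ, one_mul, ← measureReal_def] at h

end Summit.Ventures.LatticeQCDFlow.Exactness
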